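import Mathlib
import Literature.Topology.FourManifolds.PropertyRStrict
import Literature.Topology.FourManifolds.HomotopyBallSlice
import HarnessLib

/-!
# Components of an R-link are slice in a homotopy 4-ball (Hillman; Gompf–Scharlemann–Thompson 2010, Prop. 2.3)

Topic `Literature/Topology/FourManifolds`; a NAMED FACT (statement only, `def … : Prop`, D-0014),
vendored by a grounder for route `SmoothPoincare4/VerlindeRLinks`: it grounds the route item
`Summit.SmoothPoincare4.SmoothPoincare4.Theses.VerlindeRLinks.VrlComponentsHBallSlice`
(stmt-SmoothPoincare4-15874), whose Lean statement is, symbol for symbol, the componentwise form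
below.

Source, read in the held arXiv copy (arXiv:1103.1601, p. 5 of the text; = Geom. Topol. 14 (2010)
2305–2347, §2): R. E. Gompf, M. Scharlemann, A. Thompson, *Fibered knots and potential
counterexamples to the Property 2R and Slice-Ribbon Conjectures*:

> **Proposition 2.3 (Hillman).** Suppose `L` is a framed link of `n ≥ 1` components in `S³`, and
> surgery on `L` via the specified framing yields `#_n (S¹ × S²)`. Then `L` bounds a collection of
> `n` smooth `2`-disks in a `4`-dimensional homotopy ball bounded by `S³`.
>
> *Proof.* Consider the `4`-manifold trace `W` of the surgery on `L`. `∂W` has one end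
> diffeomorphic to `S³` and the other end, call it `∂₁W`, diffeomorphic to `#_n (S¹ × S²)`. `W` has
> the homotopy type of a once-punctured `♮_n (B² × S²)`. Attach `♮_n (S¹ × B³)` to `∂₁W` via the
> natural identification `∂B³ ≅ S²`. The result is a homotopy `4`-ball, and the cores of the
> original `n` `2`-handles that are attached to `L` are the required `n` `2`-disks. ∎

(attributed there to J. Hillman, *Alexander ideals of links*, LNM 895 (1981) [Hi]; the case `n = 1`
is Kirby–Melvin 1978 [KM]).

## Transcription

* The tree's vocabulary is used verbatim: `FramedLink (Fin n)` (`KirbyMoves.lean`), the surgery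
  relation `FramedLink.IsSurgery (𝓡 3) Y` (`KirbyMoves.lean` / `KirbyMovesSurgery.lean`), the
  recogniser `IsSphereTwoProdCircleSum n Y` of `#ⁿ (S² × S¹)` (`KirbyCalculus.lean`) and
  `Knot.IsHomotopyBallSlice` (`HomotopyBallSlice.lean`: `K` bounds a smooth proper disc in
  `Σ ∖ B̊⁴` for some closed smooth `Σ ≃ S⁴` — i.e. in a compact contractible `W` with `∂W = S³`,
  `Σ = W ∪ B⁴`; for the printed homotopy ball `W ∪ ♮ⁿ(S¹ × B³)` this `Σ` is the closed manifold
  `Σ_L` of `RLinkSphere.lean`).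
* WEAKER THAN PRINT, deliberately: the printed conclusion gives `n` DISJOINT discs in ONE homotopy
  ball; the tree has no predicate for a link bounding disjoint discs in `Σ ∖ B̊⁴`, and the consumer
  needs only the componentwise consequence "each component `L.component i` is slice in a homotopy
  `4`-ball", which is what is recorded. The printed hypothesis `n ≥ 1` is dropped because the
  conclusion `∀ i : Fin 0, …` is vacuous for `n = 0`.
* Nothing is asserted: users take `(h : GompfScharlemannThompson2010_prop23)`.
-/

namespace Literature.Topology.FourManifolds

open scoped Manifold ContDiff

/-- **Gompf–Scharlemann–Thompson 2010, Proposition 2.3 (Hillman)**, componentwise form: "Suppose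
`L` is a framed link of `n ≥ 1` components in `S³`, and surgery on `L` via the specified framing
yields `#_n (S¹ × S²)`. Then `L` bounds a collection of `n` smooth `2`-disks in a `4`-dimensional
homotopy ball bounded by `S³`." — hence every component of such an R-link is slice in a homotopy
`4`-ball (`Knot.IsHomotopyBallSlice`). Grounds
`Summit.SmoothPoincare4.SmoothPoincare4.Theses.VerlindeRLinks.VrlComponentsHBallSlice`
(identical statement). [cite: GompfScharlemannThompson2010, Prop. 2.3] -/
def GompfScharlemannThompson2010_prop23 : Prop :=
  ∀ (n : ℕ) (L : FramedLink (Fin n)) (Y : Type) [TopologicalSpace Y] [T2Space Y]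
    [SecondCountableTopology Y] [ChartedSpace (EuclideanSpace ℝ (Fin 3)) Y]
    [IsManifold (𝓡 3) ((⊤ : ℕ∞) : WithTop ℕ∞) Y] [CompactSpace Y] [ConnectedSpace Y],
    IsSphereTwoProdCircleSum n Y → L.IsSurgery (𝓡 3) Y →
      ∀ i : Fin n, (L.component i).IsHomotopyBallSlice

end Literature.Topology.FourManifolds
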